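import Literature.NumberTheory.Sieve.MontgomeryVaughan1975Lemma43NonExceptional
import HarnessLib

/-!
# Gallagher's prime number theorem with an adjustable exceptional threshold, and levels without
# exceptional zero (Gallagher 1970, Theorem 7; Landau–Page)

Topic `Literature/NumberTheory/Sieve`, namespace `MontgomeryVaughan1975` (the objects `gallagherTerm`,
`IsExceptionalZero` of the tree's Montgomery–Vaughan 1975 files). Everything here is PROVED; a tool
file toward `Literature.NumberTheory.DiophantineGeometry.XYZUpperHalf` ([Harper2016, Cor. 1], whose
major arcs need character sums over the primes `p ≤ y` to moduli `q ≤ y^{θ}` — the Linnik range).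

The tree's `gallagher_nonexceptional` (`MontgomeryVaughan1975Lemma43NonExceptional.lean`) is
Gallagher's Theorem 7 over the non-exceptional primitive characters,
`∑_{q ≤ P} ∑*_χ (h + N/P)⁻¹ ‖∑#_{x−h<p≤x} χ(p) log p‖ ≤ C exp(−c₁ log N/log P)`
(`exp(log^{1/2} N) ≤ P ≤ N^{c₄}`), for ONE absolute threshold `c₁` defining "exceptional"
(`IsExceptionalZero c₁ P r χ β`: a real zero `β ≥ 1 − c₁/log P` of a primitive `χ ≠ χ₀` mod
`r ≤ P`). Its proof only ever uses UPPER bounds on `c₁`. We record this: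

* `gallagher_nonexceptional_threshold` — there are absolute `c₀, c₄ > 0` such that for EVERY
  `0 < c ≤ c₀` the two clauses of `gallagher_nonexceptional` hold with threshold AND exponent `c`
  (constant `C = C(c)`); proof = the tree's proof verbatim with `c` a parameter
  (conditional form `…_of_explicitFormula_of_density`, then the four tree inputs fed in).
* `exists_level_without_exceptionalZero` — **levels free of exceptional zeros** (Landau–Page):
  for `0 < c ≤ c_U/5` (`c_U` the constant of the tree's Page uniqueness theorem
  `exists_exceptionalZero_unique`, MV I Cor. 11.8–11.10), every `θ > 0` and every `Y₀` there is
  `y ≥ Y₀` with NO exceptional datum at level `P = y^θ`. Proof: along `y_n = Y₁^{2^n}` the levels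
  satisfy `P_{n+1} = P_n²`; exceptional data at levels `P_n`, `P_{n+1}` are both
  `> 1 − c_U/log P_{n+1}`-zeros of primitive quadratic characters of conductor `≤ P_{n+1}`, hence
  coincide (Page); so one real zero `β` would satisfy `β ≥ 1 − c/log P_n` for all `n`, i.e.
  `β ≥ 1`, contradicting `β < 1`.
* `gallagher_at_good_level` — the packaged consequence used downstream: absolute `c, c₄ > 0`, `C`
  such that for every `0 < θ ≤ c₄` and `Y₀` there is `y ≥ Y₀` (with `2 ≤ y`,
  `exp(√log y) ≤ y^θ`) at whose level `y^θ` no exceptional datum occurs, so that for all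
  `x, h ≤ y`: `∑_{q ≤ y^θ} ∑*_χ (h + y^{1−θ})⁻¹ ‖∑#_{x−h<p≤x} χ(p) log p‖ ≤ C exp(−c/θ)` over ALL
  primitive characters (the `q = 1` term being `|θ(x) − θ(x−h) − h|`-type).

## References

* P. X. Gallagher, *A large sieve density estimate near `σ = 1`*, Invent. Math. 11 (1970)
  329–339, Theorem 7 [Gallagher1970].
* H. L. Montgomery, R. C. Vaughan, Acta Arith. 27 (1975) 353–370, §4 Lemmas 4.1, 4.3
  [MontgomeryVaughanActa1975]; *Multiplicative Number Theory I*, Cor. 11.8–11.10 (Landau–Page)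
  [MontgomeryVaughan2007].
* A. J. Harper, Compositio Math. 152 (2016) 1121–1158, §2.2 and Appendix (the use of Linnik-range
  character sums for smooth numbers) [Harper2016].
-/

noncomputable section

open Finset Real

namespace Literature.NumberTheory.Sieve.MontgomeryVaughan1975

open Literature.NumberTheory.LFunctions

-- one long assembly proof with a large context (the tree's proof of
-- `gallagher_nonexceptional_of_explicitFormula_of_density`, verbatim, with `c` a parameter)
set_option maxHeartbeats 1000000 in
open scoped Classical in
/-- **Gallagher's Theorem 7 over the non-exceptional characters, for every threshold `0 < c ≤ c₀`**
(conditional form): under the explicit formulae and the first part of the log-free zero-density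
estimate, there are absolute `c₀, c₄ > 0` such that for every `0 < c ≤ c₀` there is `C` with: for
`2 ≤ N`, `exp(log^{1/2} N) ≤ P ≤ N^{c₄}`, any `x, h ≤ N`, if no datum is exceptional at level
`(c, P)` then `∑_{q ≤ P} ∑*_χ (h + N/P)⁻¹ ‖∑#‖ ≤ C exp(−c log N/log P)`, and if `(r̃, χ̃, β̃)` is
exceptional at level `(c, P)` the same holds over the primitive `χ ≠ χ̃`. (The tree's theorem is the
case of one particular `c`; its proof uses only upper bounds on `c`.)
[cite: Gallagher1970, Theorem 7] [cite: MontgomeryVaughanActa1975, §4 Lemma 4.3 (4.2)] -/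
theorem gallagher_nonexceptional_threshold_of_explicitFormula_of_density
    (hEF : truncatedExplicitFormula_psiChar) (hEFζ : truncatedExplicitFormula_psi)
    {c_D C_D : ℝ} (hcD : 0 < c_D) (hCD : 0 < C_D)
    (hZDζ : ∀ P : ℝ, 2 ≤ P → ∀ α : ℝ, 0 ≤ α → α ≤ 1 →
      ∑ ρ ∈ (weilZeroIndex_finite (P ^ 6)).toFinset with α ≤ ρ.re,
        ((riemannZetaZeroOrder ρ : ℤ) : ℝ) ≤ C_D * P ^ (c_D * (1 - α)))
    (hZD : ∀ P : ℝ, 2 ≤ P → ∀ Z : (q : ℕ) → DirichletCharacter ℂ q → Finset ℂ,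
      (∀ (q' : ℕ) (χ : DirichletCharacter ℂ (q' + 1)), ∀ ρ ∈ Z (q' + 1) χ,
          χ.LFunction ρ = 0 ∧ 0 < ρ.re ∧ ρ.re < 1 ∧ |ρ.im| ≤ P ^ 6) →
      ∀ α : ℝ, 0 ≤ α → α ≤ 1 →
        ∑ q' ∈ Finset.Ico 1 ⌊P⌋₊, ∑ χ : DirichletCharacter ℂ (q' + 1) with χ.IsPrimitive,
          ∑ ρ ∈ Z (q' + 1) χ with α ≤ ρ.re, (DirichletDisc.zeroOrder χ ρ : ℝ) ≤
            C_D * P ^ (c_D * (1 - α))) :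
    ∃ c₀ : ℝ, 0 < c₀ ∧ ∃ c₄ : ℝ, 0 < c₄ ∧ ∀ c : ℝ, 0 < c → c ≤ c₀ → ∃ C : ℝ,
    ∀ (N : ℕ) (P : ℝ), 2 ≤ N → Real.exp (Real.sqrt (Real.log N)) ≤ P → P ≤ (N : ℝ) ^ c₄ →
      ∀ (x h : (q : ℕ) → DirichletCharacter ℂ q → ℕ),
        (∀ q χ, x q χ ≤ N) → (∀ q χ, h q χ ≤ N) →
        ((∀ (r : ℕ) [NeZero r] (χ : DirichletCharacter ℂ r) (β : ℝ), ¬ IsExceptionalZero c P r χ β) →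
          ∑ q ∈ Icc 1 ⌊P⌋₊, ∑ χ : DirichletCharacter ℂ q with χ.IsPrimitive,
              ((h q χ : ℝ) + N / P)⁻¹ * ‖gallagherTerm χ (x q χ) (h q χ)‖ ≤
            C * Real.exp (-c * Real.log N / Real.log P)) ∧
        (∀ (r : ℕ) [NeZero r] (χe : DirichletCharacter ℂ r) (β : ℝ), IsExceptionalZero c P r χe β →
          ∑ q ∈ Icc 1 ⌊P⌋₊, ∑ χ : DirichletCharacter ℂ q with
              (χ.IsPrimitive ∧ ¬ (q = r ∧ ∀ n : ℕ, χ (n : ZMod q) = χe (n : ZMod r))),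
              ((h q χ : ℝ) + N / P)⁻¹ * ‖gallagherTerm χ (x q χ) (h q χ)‖ ≤
            C * Real.exp (-c * Real.log N / Real.log P)) := by
  classical
  -- absolute constants
  obtain ⟨K, hK0, HK⟩ := exists_block_bound_char hEF
  obtain ⟨Cζ, hCζ0, HCζ⟩ := exists_block_bound_zeta hEFζ
  obtain ⟨c_b, hcb, Hbox⟩ := exists_boxZero_isExceptional
  obtain ⟨c_z, hcz, Hzeta⟩ := exists_zeta_no_boxZero
  obtain ⟨c_P, hcP, H41⟩ := lemma41At_of_lt
  -- the admissible thresholds `0 < c ≤ c₀`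
  set c₀ : ℝ := min (min (c_b / 10) (c_z / 10)) (min (c_P / 2) (1 / 2)) with hc₀def
  have hc₀0 : 0 < c₀ := lt_min (lt_min (by positivity) (by positivity)) (lt_min (by positivity) (by norm_num))
  -- `c₄ = min(1/20, 1/(6 + 2c_D))`
  set c₄ : ℝ := min (1 / 20) (1 / (6 + 2 * c_D)) with hc₄def
  have hc₄0 : 0 < c₄ := lt_min (by norm_num) (by positivity)
  have hc₄20 : c₄ ≤ 1 / 20 := min_le_left _ _
  have hc₄D : c₄ ≤ 1 / (6 + 2 * c_D) := min_le_right _ _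
  refine ⟨c₀, hc₀0, c₄, hc₄0, fun c hc0 hcc₀ => ?_⟩
  have hc_b : 9 * c ≤ c_b := by
    have : c₀ ≤ c_b / 10 := (min_le_left _ _).trans (min_le_left _ _)
    linarith
  have hc_z : c * (6 + 3) ≤ c_z := by
    have : c₀ ≤ c_z / 10 := (min_le_left _ _).trans (min_le_right _ _)
    linarith
  have hc_P : c < c_P := by
    have : c₀ ≤ c_P / 2 := (min_le_right _ _).trans (min_le_left _ _)
    linarith
  have hc2 : c ≤ 1 / 2 := le_trans hcc₀ ((min_le_right _ _).trans (min_le_right _ _))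
  have hc1 : c ≤ 1 := by linarith
  set M₀ : ℝ := 100 + 200 * K + 200 * Cζ with hM₀def
  have hM₀0 : 0 ≤ M₀ := by positivity
  set Cfin : ℝ := 3 + 10 * C_D * Real.exp (c * (5 + c_D)) + M₀ with hCfin
  have hCfin0 : 0 < Cfin := by positivity
  refine ⟨Cfin, fun N P hN2 hPexp hPN x h hx hh => ?_⟩
  have hP1' : 1 ≤ P := le_trans (Real.one_le_exp (Real.sqrt_nonneg _)) hPexp
  have hP0 : 0 < P := by linarith
  have hlogP0 : 0 ≤ Real.log P := Real.log_nonneg hP1'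
  have hE0 : 0 < Real.exp (-c * Real.log N / Real.log P) := Real.exp_pos _
  -- the ranges
  obtain ⟨-, h20, hP4, hPN', hP7, hP5, hlog2, hlog4⟩ := range_facts hN2 hc₄0 hc₄20 hPexp hPN
  have hP2 : 2 ≤ P := by linarith
  obtain ⟨-, hu₀2, hu₀N, hu₀lo, hu₀hi, hBu₀⟩ := scale_facts hN2 hP2 hcD hc₄D hPN
  have hbudget := error_budget_le hN2 hP4 hPN' hP7 hP5 hlog2 hlog4 hK0 hCζ0
  set u₀ : ℕ := ⌈(N : ℝ) / P ^ 5⌉₊ with hu₀def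
  set T : ℝ := P ^ 6 with hTdef
  have hT6 : P ^ (6 : ℝ) = T := by rw [hTdef]; exact_mod_cast Real.rpow_natCast P 6
  have hT2 : 2 ≤ T := by
    rw [hTdef]
    calc (2 : ℝ) ≤ 2 ^ 6 := by norm_num
      _ ≤ P ^ 6 := pow_le_pow_left₀ (by norm_num) hP2 6
  have hT0 : 0 < T := by linarith
  have hN2r : (2 : ℝ) ≤ N := by exact_mod_cast hN2
  have hN0 : (0 : ℝ) < N := by linarith
  have hlogP : 0 < Real.log P := by linarith
  have hlogN0 : 0 ≤ Real.log (N : ℝ) := Real.log_nonneg (by linarith)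
  have hLN : Real.log N ≤ Real.log P ^ 2 := by
    have hs : Real.sqrt (Real.log N) ≤ Real.log P := by
      have := Real.log_le_log (Real.exp_pos _) hPexp
      rwa [Real.log_exp] at this
    calc Real.log (N : ℝ) = Real.sqrt (Real.log N) ^ 2 := (Real.sq_sqrt hlogN0).symm
      _ ≤ Real.log P ^ 2 := pow_le_pow_left₀ (Real.sqrt_nonneg _) hs 2
  have hfloorP : 1 ≤ ⌊P⌋₊ := Nat.le_floor (by exact_mod_cast hP1')
  have hfloorle : (⌊P⌋₊ : ℝ) ≤ P := Nat.floor_le hP0.le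
  -- the parameters of the density lemma
  set B : ℝ := P ^ c_D with hBdef
  set η : ℝ := c / Real.log P with hηdef
  have hB1 : 1 ≤ B := Real.one_le_rpow hP1' hcD.le
  have hu₀1 : (1 : ℝ) < u₀ := by
    have : (2 : ℝ) ≤ u₀ := by exact_mod_cast hu₀2
    linarith
  have hη1 : η ≤ 1 := by
    rw [hηdef, div_le_one hlogP]; linarith
  have hη0 : 0 ≤ η := div_nonneg hc0.le hlogP.le
  have hsaving : (B / u₀) ^ η ≤ Real.exp (c * (5 + c_D)) * Real.exp (-c * Real.log N / Real.log P) :=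
    saving_le hN0 (by linarith) hc0.le hu₀lo
  -- the error budget
  set E : ℝ := 2 * Real.sqrt N * Real.log N + 2 * Real.log (N + 1) +
    K * (Real.log N + N / T * Real.log (P * N * T) ^ 2) with hEdef
  set Eζ : ℝ := 2 * Real.sqrt N * Real.log N + 2 * Real.log N + 1 +
    Cζ * (Real.log N + N / T * Real.log (N * T) ^ 2) with hEζdef
  have hlogN1 : 0 ≤ Real.log ((N : ℝ) + 1) := Real.log_nonneg (by linarith)
  have hlog40 : 0 ≤ Real.log 4 := Real.log_nonneg (by norm_num)
  have hEnn : 0 ≤ E := by rw [hEdef]; positivity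
  have hEζnn : 0 ≤ Eζ := by rw [hEζdef]; positivity
  have hu₀r0 : (0 : ℝ) ≤ u₀ := Nat.cast_nonneg _
  have hbudget' : 2 * P ^ 3 / N * ((Real.log 4 + 2) * u₀ + E + Eζ + 1) ≤ M₀ / P ^ 2 := by
    refine le_trans ?_ (hbudget.trans_eq (by rw [hM₀def]))
    apply mul_le_mul_of_nonneg_left _ (by positivity)
    have h3 : 0 ≤ Real.log 4 + 2 := by linarith
    linarith [mul_le_mul_of_nonneg_left hu₀hi h3]
  -- the uniform per-pair error and its sum over the pairs
  set err : ℝ := P / N * ((Real.log 4 + 2) * u₀ + E + Eζ + 1) with herrdef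
  have herr0 : 0 ≤ err := by rw [herrdef]; positivity
  have hpairs : err * (1 + ∑ q' ∈ Ico 1 ⌊P⌋₊, ((q' : ℝ) + 1)) ≤ M₀ / P ^ 2 := by
    have h1 : 1 + ∑ q' ∈ Ico 1 ⌊P⌋₊, ((q' : ℝ) + 1) ≤ 2 * P ^ 2 := by
      have := sum_Ico_succ_le_sq hfloorle
      have hP21 : (1 : ℝ) ≤ P ^ 2 := one_le_pow₀ hP1'
      linarith
    calc err * (1 + ∑ q' ∈ Ico 1 ⌊P⌋₊, ((q' : ℝ) + 1)) ≤ err * (2 * P ^ 2) :=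
          mul_le_mul_of_nonneg_left h1 herr0
      _ = 2 * P ^ 3 / N * ((Real.log 4 + 2) * u₀ + E + Eζ + 1) := by
          rw [herrdef]; ring
      _ ≤ M₀ / P ^ 2 := hbudget'
  -- the finite sets of zeros
  set Zfin : (q : ℕ) → DirichletCharacter ℂ q → Finset ℂ := fun q χ =>
    if hq : q = 0 then ∅ else
      haveI : NeZero q := ⟨hq⟩
      if hχ : χ = 1 then ∅ else (lfunctionZeroBox_finite hχ T).toFinset with hZfin
  have hZfin_eq : ∀ (q' : ℕ) (χ : DirichletCharacter ℂ (q' + 1)) (hχ : χ ≠ 1),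
      Zfin (q' + 1) χ = (lfunctionZeroBox_finite hχ T).toFinset := by
    intro q' χ hχ
    simp only [hZfin]
    rw [dif_neg (Nat.succ_ne_zero q'), dif_neg hχ]
  have hZfin_mem : ∀ (q' : ℕ) (χ : DirichletCharacter ℂ (q' + 1)), ∀ ρ ∈ Zfin (q' + 1) χ,
      χ.LFunction ρ = 0 ∧ 0 < ρ.re ∧ ρ.re < 1 ∧ |ρ.im| ≤ P ^ 6 := by
    intro q' χ ρ hρ
    by_cases hχ : χ = 1
    · subst hχ; simp [hZfin] at hρ
    · rw [hZfin_eq q' χ hχ] at hρ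
      exact mem_toFinset_lfunctionZeroBox hχ hρ
  -- primitive characters mod `q' + 1 ≥ 2` are non-principal
  have hne1 : ∀ (q' : ℕ), 1 ≤ q' → ∀ (χ : DirichletCharacter ℂ (q' + 1)), χ.IsPrimitive → χ ≠ 1 := by
    intro q' hq' χ hprim hχ
    subst hχ
    have := eq_one_of_isPrimitive_one hprim
    omega
  -- reindex the sum over `q`
  have hsplit : ∀ F : ℕ → ℝ, ∑ q ∈ Icc 1 ⌊P⌋₊, F q = F 1 + ∑ q' ∈ Ico 1 ⌊P⌋₊, F (q' + 1) :=
    fun F => sum_Icc_one_eq F hfloorP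
  -- the zeros of `ζ` in the box (the classical zero-free region: no exceptional zero for `ζ`)
  set Sζ := (weilZeroIndex_finite T).toFinset with hSζ
  have hζre : ∀ ρ ∈ Sζ, ρ.re ≤ 1 - η := by
    intro ρ hρ
    obtain ⟨h0, -, -, -, h4, -⟩ := mem_toFinset_weilZeroIndex hρ
    have := Hzeta 6 (by norm_num) c P hc0 hc_z hP2 ρ h0 (by rw [hT6]; exact h4)
    rwa [hηdef]
  have hζpos : ∀ ρ ∈ Sζ, 0 ≤ ρ.re := fun ρ hρ => (mem_toFinset_weilZeroIndex hρ).2.1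
  have hζw : ∀ ρ ∈ Sζ, 0 ≤ ((riemannZetaZeroOrder ρ : ℤ) : ℝ) := fun ρ hρ =>
    (mem_toFinset_weilZeroIndex hρ).2.2.2.2.2.2.2
  set Uζ : ℝ := ∑ ρ ∈ Sζ, ((riemannZetaZeroOrder ρ : ℤ) : ℝ) * (u₀ : ℝ) ^ (ρ.re - 1) with hUζdef
  have hUζ0 : 0 ≤ Uζ := Finset.sum_nonneg fun ρ hρ => by
    have := hζw ρ hρ; positivity
  have hUζ : Uζ ≤ 5 * C_D * (B / u₀) ^ η := by
    refine sum_mul_rpow_sub_one_le_of_density₀ Sζ (fun ρ => ρ.re)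
      (fun ρ => ((riemannZetaZeroOrder ρ : ℤ) : ℝ)) hu₀1 hB1 hBu₀ hCD.le hη1 hζw hζpos hζre ?_
    intro α' hα'0 hα'1
    have h := hZDζ P hP2 α' hα'0 (by linarith)
    rw [hBdef, ← Real.rpow_mul hP0.le]
    exact h
  -- the `q = 1` term: one character, `ζ`
  have hcard1 : (((univ : Finset (DirichletCharacter ℂ 1)).filter fun χ => χ.IsPrimitive).card : ℝ) ≤ 1 := by
    have := card_filter_isPrimitive_le_self 1
    exact this.trans_eq (by norm_num)
  have hterm1 : ∀ χ : DirichletCharacter ℂ 1,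
      ((h 1 χ : ℝ) + N / P)⁻¹ * ‖gallagherTerm χ (x 1 χ) (h 1 χ)‖ ≤ Uζ + err := by
    intro χ
    have := weighted_gallagherTerm_modOne_le hCζ0 HCζ hP2 hT2 χ hu₀2 hu₀N (hx 1 χ) (h := h 1 χ)
    refine this.trans (add_le_add le_rfl ?_)
    rw [herrdef]
    apply mul_le_mul_of_nonneg_left _ (by positivity)
    rw [hEζdef]
    linarith
  ------------------------------------------------------------------
  -- the core: the sum over any sub-family `F` of the primitive characters all of whose zeros in
  -- the box have `Re ρ ≤ 1 − η`
  have core : ∀ F : (q : ℕ) → Finset (DirichletCharacter ℂ q),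
      (∀ (q : ℕ) (χ : DirichletCharacter ℂ q), χ ∈ F q → χ.IsPrimitive) →
      (∀ q' ∈ Ico 1 ⌊P⌋₊, ∀ χ ∈ F (q' + 1), ∀ ρ ∈ Zfin (q' + 1) χ, ρ.re ≤ 1 - η) →
      ∑ q ∈ Icc 1 ⌊P⌋₊, ∑ χ ∈ F q, ((h q χ : ℝ) + N / P)⁻¹ * ‖gallagherTerm χ (x q χ) (h q χ)‖ ≤
        Cfin * Real.exp (-c * Real.log N / Real.log P) := by
    intro F hFprim hre
    have hsubF : ∀ q : ℕ, F q ⊆ (univ : Finset (DirichletCharacter ℂ q)).filter fun χ => χ.IsPrimitive :=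
      fun q χ hχ => Finset.mem_filter.mpr ⟨Finset.mem_univ _, hFprim q χ hχ⟩
    -- the sets of zeros with the zeros of the characters outside `F` removed
    set Z' : (q : ℕ) → DirichletCharacter ℂ q → Finset ℂ := fun q χ =>
      if χ ∈ F q then Zfin q χ else ∅ with hZ'
    have hZ'_mem : ∀ (q' : ℕ) (χ : DirichletCharacter ℂ (q' + 1)), ∀ ρ ∈ Z' (q' + 1) χ,
        χ.LFunction ρ = 0 ∧ 0 < ρ.re ∧ ρ.re < 1 ∧ |ρ.im| ≤ P ^ 6 := by
      intro q' χ ρ hρ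
      by_cases hm : χ ∈ F (q' + 1)
      · simp only [hZ', if_pos hm] at hρ
        exact hZfin_mem q' χ ρ hρ
      · simp [hZ', hm] at hρ
    -- the zero sums over the sub-family
    have hUsum : ∑ q' ∈ Ico 1 ⌊P⌋₊, ∑ χ ∈ F (q' + 1),
        ∑ ρ ∈ Zfin (q' + 1) χ, (DirichletDisc.zeroOrder χ ρ : ℝ) * (u₀ : ℝ) ^ (ρ.re - 1) ≤
          5 * C_D * (B / u₀) ^ η := by
      refine sum_sum_sum_mul_rpow_le_of_density₀ (Ico 1 ⌊P⌋₊) (fun q' => F (q' + 1))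
        (fun q' χ => Zfin (q' + 1) χ) (fun q' χ ρ => (DirichletDisc.zeroOrder χ ρ : ℝ))
        hu₀1 hB1 hBu₀ hCD.le hη1 (fun _ _ _ _ _ _ => Nat.cast_nonneg _)
        (fun q' _ χ _ ρ hρ => (hZfin_mem q' χ ρ hρ).2.1.le) hre ?_
      intro α' hα'0 hα'1
      have hd := hZD P hP2 Z' hZ'_mem α' hα'0 (by linarith)
      rw [hBdef, ← Real.rpow_mul hP0.le]
      refine le_trans (le_of_eq ?_) hd
      refine Finset.sum_congr rfl fun q' _ => ?_
      calc ∑ χ ∈ F (q' + 1), ∑ ρ ∈ (Zfin (q' + 1) χ).filter (fun ρ => α' ≤ ρ.re),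
            (DirichletDisc.zeroOrder χ ρ : ℝ)
          = ∑ χ ∈ ((univ : Finset (DirichletCharacter ℂ (q' + 1))).filter
              (fun χ => χ.IsPrimitive)).filter (fun χ => χ ∈ F (q' + 1)),
              ∑ ρ ∈ (Zfin (q' + 1) χ).filter (fun ρ => α' ≤ ρ.re),
                (DirichletDisc.zeroOrder χ ρ : ℝ) := by
            rw [Finset.filter_mem_eq_inter, Finset.inter_eq_right.mpr (hsubF (q' + 1))]
        _ = ∑ χ ∈ (univ : Finset (DirichletCharacter ℂ (q' + 1))).filter (fun χ => χ.IsPrimitive),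
              if χ ∈ F (q' + 1) then ∑ ρ ∈ (Zfin (q' + 1) χ).filter (fun ρ => α' ≤ ρ.re),
                (DirichletDisc.zeroOrder χ ρ : ℝ) else 0 := Finset.sum_filter _ _
        _ = _ := by
            refine Finset.sum_congr rfl fun χ _ => ?_
            by_cases hm : χ ∈ F (q' + 1)
            · simp only [if_pos hm, hZ']
            · simp only [if_neg hm, hZ']
              simp
    -- the terms with `q' + 1 ≥ 2`
    have hterm : ∀ q' ∈ Ico 1 ⌊P⌋₊, ∀ χ ∈ F (q' + 1),
        ((h (q' + 1) χ : ℝ) + N / P)⁻¹ * ‖gallagherTerm χ (x (q' + 1) χ) (h (q' + 1) χ)‖ ≤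
          (∑ ρ ∈ Zfin (q' + 1) χ, (DirichletDisc.zeroOrder χ ρ : ℝ) * (u₀ : ℝ) ^ (ρ.re - 1)) + err := by
      intro q' hq' χ hχ
      rw [Finset.mem_Ico] at hq'
      have hprim := hFprim _ χ hχ
      have hχ1 := hne1 q' hq'.1 χ hprim
      have hqP : ((q' + 1 : ℕ) : ℝ) ≤ P := by
        have : ((q' + 1 : ℕ) : ℝ) ≤ ⌊P⌋₊ := by exact_mod_cast hq'.2
        exact this.trans hfloorle
      have hq2 : 1 < q' + 1 := by omega
      have := weighted_gallagherTerm_le hK0 HK hP2 hT2 hq2 hqP hprim hχ1 hu₀2 hu₀N (hx (q' + 1) χ)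
        (h := h (q' + 1) χ)
      rw [hZfin_eq q' χ hχ1]
      refine this.trans (add_le_add le_rfl ?_)
      rw [herrdef]
      apply mul_le_mul_of_nonneg_left _ (by positivity)
      rw [hEdef]
      linarith
    have hcard : ∀ q' : ℕ, ((F (q' + 1)).card : ℝ) ≤ (q' : ℝ) + 1 := by
      intro q'
      have h1 : (F (q' + 1)).card ≤
          ((univ : Finset (DirichletCharacter ℂ (q' + 1))).filter fun χ => χ.IsPrimitive).card :=
        Finset.card_le_card (hsubF (q' + 1))
      have h2 := card_filter_isPrimitive_le_self (q' + 1)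
      push_cast at h2
      exact le_trans (by exact_mod_cast h1) h2
    have hsum2 : ∑ q' ∈ Ico 1 ⌊P⌋₊, ∑ χ ∈ F (q' + 1),
        ((h (q' + 1) χ : ℝ) + N / P)⁻¹ * ‖gallagherTerm χ (x (q' + 1) χ) (h (q' + 1) χ)‖ ≤
        5 * C_D * (B / u₀) ^ η + err * ∑ q' ∈ Ico 1 ⌊P⌋₊, ((q' : ℝ) + 1) := by
      calc _ ≤ ∑ q' ∈ Ico 1 ⌊P⌋₊, ∑ χ ∈ F (q' + 1),
            ((∑ ρ ∈ Zfin (q' + 1) χ, (DirichletDisc.zeroOrder χ ρ : ℝ) * (u₀ : ℝ) ^ (ρ.re - 1)) + err) :=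
            Finset.sum_le_sum fun q' hq' => Finset.sum_le_sum fun χ hχ => hterm q' hq' χ hχ
        _ = (∑ q' ∈ Ico 1 ⌊P⌋₊, ∑ χ ∈ F (q' + 1),
              ∑ ρ ∈ Zfin (q' + 1) χ, (DirichletDisc.zeroOrder χ ρ : ℝ) * (u₀ : ℝ) ^ (ρ.re - 1)) +
            ∑ q' ∈ Ico 1 ⌊P⌋₊, ∑ χ ∈ F (q' + 1), err := by
            rw [← Finset.sum_add_distrib]
            refine Finset.sum_congr rfl fun q' _ => ?_
            rw [Finset.sum_add_distrib]
        _ ≤ 5 * C_D * (B / u₀) ^ η + err * ∑ q' ∈ Ico 1 ⌊P⌋₊, ((q' : ℝ) + 1) := by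
            refine add_le_add hUsum ?_
            rw [Finset.mul_sum]
            refine Finset.sum_le_sum fun q' _ => ?_
            rw [Finset.sum_const, nsmul_eq_mul]
            calc _ ≤ ((q' : ℝ) + 1) * err := mul_le_mul_of_nonneg_right (hcard q') herr0
              _ = err * ((q' : ℝ) + 1) := mul_comm _ _
    -- the `q = 1` term of the restricted sum
    have hsum1 : ∑ χ ∈ F 1, ((h 1 χ : ℝ) + N / P)⁻¹ * ‖gallagherTerm χ (x 1 χ) (h 1 χ)‖ ≤ Uζ + err := by
      have hcard1' : ((F 1).card : ℝ) ≤ 1 := by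
        refine le_trans ?_ hcard1
        exact_mod_cast Finset.card_le_card (hsubF 1)
      calc _ ≤ ((F 1).card : ℝ) * (Uζ + err) := by
            rw [← nsmul_eq_mul]
            exact Finset.sum_le_card_nsmul _ _ _ fun χ _ => hterm1 χ
        _ ≤ 1 * (Uζ + err) := mul_le_mul_of_nonneg_right hcard1' (by positivity)
        _ = Uζ + err := one_mul _
    -- assemble
    rw [hsplit (fun q => ∑ χ ∈ F q, ((h q χ : ℝ) + N / P)⁻¹ * ‖gallagherTerm χ (x q χ) (h q χ)‖)]
    have hinvsq : (P ^ 2)⁻¹ ≤ Real.exp (-c * Real.log N / Real.log P) :=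
      inv_sq_le_exp_neg hP1' hc1 hlogN0 hLN
    calc _ ≤ (Uζ + err) + (5 * C_D * (B / u₀) ^ η + err * ∑ q' ∈ Ico 1 ⌊P⌋₊, ((q' : ℝ) + 1)) :=
          add_le_add hsum1 hsum2
      _ = (Uζ + 5 * C_D * (B / u₀) ^ η) + err * (1 + ∑ q' ∈ Ico 1 ⌊P⌋₊, ((q' : ℝ) + 1)) := by ring
      _ ≤ 10 * C_D * (B / u₀) ^ η + M₀ / P ^ 2 := by linarith [hUζ, hpairs]
      _ ≤ 10 * C_D * (Real.exp (c * (5 + c_D)) * Real.exp (-c * Real.log N / Real.log P)) +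
            M₀ * Real.exp (-c * Real.log N / Real.log P) := by
          refine add_le_add (mul_le_mul_of_nonneg_left hsaving (by positivity)) ?_
          rw [div_eq_mul_inv]
          exact mul_le_mul_of_nonneg_left hinvsq hM₀0
      _ ≤ Cfin * Real.exp (-c * Real.log N / Real.log P) := by
          rw [hCfin]
          have : 0 ≤ 3 * Real.exp (-c * Real.log N / Real.log P) := by positivity
          linarith [this]
  ------------------------------------------------------------------
  refine ⟨fun hnone => ?_, fun r _ χe β hEZ => ?_⟩
  · -- (a) no exceptional datum at level `c`: the whole family
    refine core _ (fun q χ hχ => (Finset.mem_filter.mp hχ).2) (fun q' hq' χ hχ ρ hρ => ?_)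
    rw [Finset.mem_Ico] at hq'
    have hprim : χ.IsPrimitive := (Finset.mem_filter.mp hχ).2
    have hχ1 := hne1 q' hq'.1 χ hprim
    obtain ⟨hL, -, -, him⟩ := hZfin_mem q' χ ρ hρ
    have hqP : ((q' + 1 : ℕ) : ℝ) ≤ P := by
      have : ((q' + 1 : ℕ) : ℝ) ≤ ⌊P⌋₊ := by exact_mod_cast hq'.2
      exact this.trans hfloorle
    have := boxZero_re_le_of_none Hbox hc0 hc_b hP2 hnone hprim hχ1 hqP hL (by rw [hT6]; exact him)
    rwa [hηdef]
  · -- (b) the exceptional datum `(r, χe, β)` at level `c`: the family without `χe`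
    have h41 : Lemma41At c P := H41 c P hc0 hc_P hP4
    refine core _ (fun q χ hχ => (Finset.mem_filter.mp hχ).2.1) (fun q' hq' χ hχ ρ hρ => ?_)
    rw [Finset.mem_Ico] at hq'
    obtain ⟨-, hprim, hEx⟩ := Finset.mem_filter.mp hχ
    have hχ1 := hne1 q' hq'.1 χ hprim
    obtain ⟨hL, -, -, him⟩ := hZfin_mem q' χ ρ hρ
    have hqP : ((q' + 1 : ℕ) : ℝ) ≤ P := by
      have : ((q' + 1 : ℕ) : ℝ) ≤ ⌊P⌋₊ := by exact_mod_cast hq'.2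
      exact this.trans hfloorle
    have hne : ¬ (q' + 1 = r ∧ (∀ n : ℕ, χ (n : ZMod (q' + 1)) = χe (n : ZMod r)) ∧
        ρ = ((β : ℝ) : ℂ)) := fun hh => hEx ⟨hh.1, hh.2.1⟩
    have := boxZero_re_le_of_exceptional Hbox hc0 hc_b hP2 h41 hEZ hprim hχ1 hqP hL
      (by rw [hT6]; exact him) hne
    rwa [hηdef]

open scoped Classical in
/-- **Gallagher's Theorem 7 over the non-exceptional characters, for every threshold
`0 < c ≤ c₀` — UNCONDITIONAL** (inputs: the tree's truncated explicit formulae and the first part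
of Bombieri's Théorème 14 for `ζ` and for the primitive characters).
[cite: Gallagher1970, Theorem 7] [cite: MontgomeryVaughanActa1975, §4 Lemma 4.3 (4.2)]
[cite: Bombieri1987GrandCrible, §6 Théorème 14] -/
theorem gallagher_nonexceptional_threshold :
    ∃ c₀ : ℝ, 0 < c₀ ∧ ∃ c₄ : ℝ, 0 < c₄ ∧ ∀ c : ℝ, 0 < c → c ≤ c₀ → ∃ C : ℝ,
    ∀ (N : ℕ) (P : ℝ), 2 ≤ N → Real.exp (Real.sqrt (Real.log N)) ≤ P → P ≤ (N : ℝ) ^ c₄ →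
      ∀ (x h : (q : ℕ) → DirichletCharacter ℂ q → ℕ),
        (∀ q χ, x q χ ≤ N) → (∀ q χ, h q χ ≤ N) →
        ((∀ (r : ℕ) [NeZero r] (χ : DirichletCharacter ℂ r) (β : ℝ), ¬ IsExceptionalZero c P r χ β) →
          ∑ q ∈ Icc 1 ⌊P⌋₊, ∑ χ : DirichletCharacter ℂ q with χ.IsPrimitive,
              ((h q χ : ℝ) + N / P)⁻¹ * ‖gallagherTerm χ (x q χ) (h q χ)‖ ≤
            C * Real.exp (-c * Real.log N / Real.log P)) ∧
        (∀ (r : ℕ) [NeZero r] (χe : DirichletCharacter ℂ r) (β : ℝ), IsExceptionalZero c P r χe β →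
          ∑ q ∈ Icc 1 ⌊P⌋₊, ∑ χ : DirichletCharacter ℂ q with
              (χ.IsPrimitive ∧ ¬ (q = r ∧ ∀ n : ℕ, χ (n : ZMod q) = χe (n : ZMod r))),
              ((h q χ : ℝ) + N / P)⁻¹ * ‖gallagherTerm χ (x q χ) (h q χ)‖ ≤
            C * Real.exp (-c * Real.log N / Real.log P)) := by
  classical
  obtain ⟨c_D, C_D, hcD, hCD, hZD⟩ := LogFreeDensity.logFreeDensity_dirichlet
  obtain ⟨c_D', C_D', hcD', hCD', hZDζ⟩ := LogFreeDensity.logFreeDensity_zeta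
  have key := gallagher_nonexceptional_threshold_of_explicitFormula_of_density
    truncatedExplicitFormula_psiChar_holds truncatedExplicitFormula_psi_holds
    (c_D := max c_D c_D') (C_D := max C_D C_D') (by positivity) (by positivity) ?_ ?_
  · exact key
  · intro P hP α hα0 hα1
    refine (hZDζ P hP α hα0 hα1).trans ?_
    refine mul_le_mul (le_max_right _ _) ?_ (by positivity) (by positivity)
    exact Real.rpow_le_rpow_of_exponent_le (by linarith)
      (mul_le_mul_of_nonneg_right (le_max_right _ _) (by linarith))
  · intro P hP Z hZ α hα0 hα1
    refine (hZD P hP Z hZ α hα0 hα1).trans ?_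
    refine mul_le_mul (le_max_left _ _) ?_ (by positivity) (by positivity)
    exact Real.rpow_le_rpow_of_exponent_le (by linarith)
      (mul_le_mul_of_nonneg_right (le_max_left _ _) (by linarith))

/-! ### Levels without exceptional zero -/

/-- **Levels free of exceptional zeros (Landau–Page).** There is an absolute `c₀' > 0` such that for
every threshold `0 < c ≤ c₀'`, every exponent `θ > 0` and every `Y₀` there is a natural number
`y ≥ Y₀`, `y ≥ 2`, such that NO primitive character `χ ≠ χ₀` of modulus `r ≤ y^θ` has a real zero
`β ∈ [1 − c/log(y^θ), 1)` — i.e. no datum is exceptional at level `(c, y^θ)`. Proof: with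
`y_n = Y₁^{2^n}` (`Y₁ ≥ max(Y₀, 2)`, `Y₁^θ ≥ 4`) the levels `P_n = y_n^θ` satisfy `P_{n+1} = P_n²`;
if every `P_n` carried an exceptional datum, consecutive data would be two real zeros
`> 1 − c_U/log P_{n+1}` of primitive characters of conductor `≤ P_{n+1}` (as `2c < c_U`), hence
quadratic and EQUAL by Page's theorem (`exists_exceptionalZero_unique`); the common zero `β < 1`
would satisfy `1 − β ≤ c/log P_n = c/(2^n log P_0)` for all `n`, absurd.
[cite: MontgomeryVaughan2007, Corollaries 11.8–11.10 (Landau–Page)] -/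
theorem exists_level_without_exceptionalZero :
    ∃ c₀' : ℝ, 0 < c₀' ∧ ∀ c : ℝ, 0 < c → c ≤ c₀' → ∀ θ : ℝ, 0 < θ → ∀ Y₀ : ℕ,
      ∃ y : ℕ, Y₀ ≤ y ∧ 2 ≤ y ∧ 4 ≤ (y : ℝ) ^ θ ∧
        ∀ (r : ℕ) [NeZero r] (χ : DirichletCharacter ℂ r) (β : ℝ),
          ¬ IsExceptionalZero c ((y : ℝ) ^ θ) r χ β := by
  obtain ⟨cU, hcU, hU⟩ := exists_exceptionalZero_unique
  refine ⟨cU / 5, by positivity, fun c hc hccU θ hθ Y₀ => ?_⟩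
  -- a starting point `Y₁ ≥ max(Y₀, 2)` with `Y₁^θ ≥ 4`
  obtain ⟨Y₁, hY₁Y₀, hY₁2, hY₁θ⟩ : ∃ Y₁ : ℕ, Y₀ ≤ Y₁ ∧ 2 ≤ Y₁ ∧ 4 ≤ (Y₁ : ℝ) ^ θ := by
    refine ⟨max (max Y₀ 2) ⌈(4 : ℝ) ^ (1 / θ)⌉₊, (le_max_left _ _).trans (le_max_left _ _),
      (le_max_right _ _).trans (le_max_left _ _), ?_⟩
    have h1 : (4 : ℝ) ^ (1 / θ) ≤ (max (max Y₀ 2) ⌈(4 : ℝ) ^ (1 / θ)⌉₊ : ℕ) := by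
      calc (4 : ℝ) ^ (1 / θ) ≤ ⌈(4 : ℝ) ^ (1 / θ)⌉₊ := Nat.le_ceil _
        _ ≤ _ := by exact_mod_cast le_max_right _ _
    calc (4 : ℝ) = ((4 : ℝ) ^ (1 / θ)) ^ θ := by
          rw [← Real.rpow_mul (by norm_num), one_div_mul_cancel hθ.ne', Real.rpow_one]
      _ ≤ _ := Real.rpow_le_rpow (by positivity) h1 hθ.le
  -- the levels `y_n = Y₁^(2^n)`, `P_n = y_n^θ`
  set ys : ℕ → ℕ := fun n => Y₁ ^ (2 ^ n) with hys
  set Ps : ℕ → ℝ := fun n => ((ys n : ℕ) : ℝ) ^ θ with hPs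
  have hY₁r : (2 : ℝ) ≤ Y₁ := by exact_mod_cast hY₁2
  have hY₁1 : (1 : ℝ) < Y₁ := by linarith
  have hlogY₁ : 0 < Real.log Y₁ := Real.log_pos hY₁1
  have hys_real : ∀ n, ((ys n : ℕ) : ℝ) = (Y₁ : ℝ) ^ (2 ^ n : ℕ) := fun n => by
    simp [hys]
  have hPs_eq : ∀ n, Ps n = (Y₁ : ℝ) ^ ((2 : ℝ) ^ n * θ) := fun n => by
    show ((ys n : ℕ) : ℝ) ^ θ = _
    rw [hys_real n, ← Real.rpow_natCast, ← Real.rpow_mul (by positivity), Nat.cast_pow,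
      Nat.cast_ofNat]
  have hlogPs : ∀ n, Real.log (Ps n) = 2 ^ n * θ * Real.log Y₁ := fun n => by
    rw [hPs_eq, Real.log_rpow (by positivity)]
  have hPs_succ : ∀ n, Ps (n + 1) = Ps n ^ 2 := fun n => by
    rw [hPs_eq, hPs_eq, sq, ← Real.rpow_add (by positivity)]
    congr 1
    rw [pow_succ]
    ring
  have hPs0 : ∀ n, 4 ≤ Ps n := by
    intro n
    induction n with
    | zero =>
        have : Ps 0 = (Y₁ : ℝ) ^ θ := by simp [hPs, hys]
        rw [this]; exact hY₁θ
    | succ n ih =>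
        rw [hPs_succ]
        nlinarith
  have hlogPs0 : ∀ n, 0 < Real.log (Ps n) := fun n => Real.log_pos (by linarith [hPs0 n])
  have hys_ge : ∀ n, Y₁ ≤ ys n := fun n => by
    simp only [hys]
    calc Y₁ = Y₁ ^ 1 := (pow_one _).symm
      _ ≤ Y₁ ^ (2 ^ n) := Nat.pow_le_pow_right (by omega) Nat.one_le_two_pow
  -- suppose every level carries an exceptional datum
  by_contra hcon
  push Not at hcon
  have hex : ∀ n : ℕ, ∃ (r : ℕ) (_ : NeZero r) (χ : DirichletCharacter ℂ r) (β : ℝ),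
      IsExceptionalZero c (Ps n) r χ β := by
    intro n
    obtain ⟨r, inst, χ, β, h⟩ := hcon (ys n) (hY₁Y₀.trans (hys_ge n)) (hY₁2.trans (hys_ge n))
      (hPs0 n)
    exact ⟨r, inst, χ, β, h⟩
  choose r inst χ β hEZ using hex
  -- consecutive data coincide (Page), in particular the zeros
  have hstep : ∀ n, β (n + 1) = β n := by
    intro n
    haveI := inst n
    haveI := inst (n + 1)
    obtain ⟨hp₁, hne₁, hr₁, hβ₁, hβ₁1, hz₁⟩ := hEZ n
    obtain ⟨hp₂, hne₂, hr₂, hβ₂, hβ₂1, hz₂⟩ := hEZ (n + 1)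
    set T : ℝ := Ps (n + 1) with hT
    have hT4 : 4 ≤ T := hPs0 (n + 1)
    obtain ⟨hZ, hUq⟩ := hU T hT4
    have hlogT : Real.log T = 2 * Real.log (Ps n) := by
      rw [hT, hPs_succ, Real.log_pow]; push_cast; ring
    have hlogT0 : 0 < Real.log T := by rw [hlogT]; linarith [hlogPs0 n]
    -- both zeros lie above `1 - cU/log T`
    have hthr₁ : 1 - cU / Real.log T < β n := by
      have h1 : c / Real.log (Ps n) = 2 * c / Real.log T := by
        rw [hlogT]; field_simp
      have h2 : 2 * c / Real.log T < cU / Real.log T := by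
        apply div_lt_div_of_pos_right _ hlogT0; linarith
      linarith
    have hthr₂ : 1 - cU / Real.log T < β (n + 1) := by
      have h2 : c / Real.log T < cU / Real.log T := by
        apply div_lt_div_of_pos_right _ hlogT0; linarith
      linarith
    have hrT₁ : ((r n : ℕ) : ℝ) ≤ T := by
      refine hr₁.trans ?_
      rw [hT, hPs_succ]
      nlinarith [hPs0 n]
    have hrT₂ : ((r (n + 1) : ℕ) : ℝ) ≤ T := hr₂
    -- quadratic (first clause of Page's theorem at level `T`)
    have hq₁ : χ n ^ 2 = 1 := by
      have := hZ (r n) (χ n) hne₁ hrT₁ ((β n : ℝ) : ℂ) (by exact_mod_cast hz₁)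
        (by simp; linarith) (by simpa using hthr₁)
      exact this.1
    have hq₂ : χ (n + 1) ^ 2 = 1 := by
      have := hZ (r (n + 1)) (χ (n + 1)) hne₂ hrT₂ ((β (n + 1) : ℝ) : ℂ) (by exact_mod_cast hz₂)
        (by simp; linarith) (by simpa using hthr₂)
      exact this.1
    obtain ⟨-, hββ, -⟩ := hUq (r n) (r (n + 1)) (χ n) (χ (n + 1)) hne₁ hne₂ hp₁ hp₂ hq₁ hq₂ hrT₁ hrT₂
      (β n) (β (n + 1)) hz₁ hz₂ hthr₁ hthr₂
    exact hββ.symm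
  have hconst : ∀ n, β n = β 0 := by
    intro n
    induction n with
    | zero => rfl
    | succ n ih => rw [hstep, ih]
  -- the common zero is `≥ 1 - c/(2^n θ log Y₁)` for every `n`, hence `≥ 1`
  haveI := inst 0
  obtain ⟨-, -, -, -, hβ01, -⟩ := hEZ 0
  have hgap : 0 < 1 - β 0 := by linarith
  -- choose `n` with `2^n > c/(θ log Y₁ (1 - β 0))`
  obtain ⟨n, hn⟩ := pow_unbounded_of_one_lt (c / (θ * Real.log Y₁ * (1 - β 0))) one_lt_two
  haveI := inst n
  obtain ⟨-, -, -, hβn, -, -⟩ := hEZ n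
  rw [hconst n, hlogPs n] at hβn
  -- `1 - β 0 ≤ c/(2^n θ log Y₁) < 1 - β 0`
  have hpos : 0 < 2 ^ n * θ * Real.log Y₁ := by positivity
  have h1 : 1 - β 0 ≤ c / (2 ^ n * θ * Real.log Y₁) := by linarith
  have h2 : c / (2 ^ n * θ * Real.log Y₁) < 1 - β 0 := by
    rw [div_lt_iff₀ hpos]
    have h3 : c / (θ * Real.log Y₁ * (1 - β 0)) < 2 ^ n := hn
    rw [div_lt_iff₀ (by positivity)] at h3
    nlinarith
  linarith

/-- `exp(√log y) ≤ y^θ` once `log y ≥ 1/θ²` (`y ≥ 1`). [folklore] -/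
theorem exp_sqrt_log_le_rpow {y θ : ℝ} (hy : 1 ≤ y) (hθ : 0 < θ) (h : 1 / θ ^ 2 ≤ Real.log y) :
    Real.exp (Real.sqrt (Real.log y)) ≤ y ^ θ := by
  have hlog0 : 0 ≤ Real.log y := Real.log_nonneg hy
  rw [Real.rpow_def_of_pos (by linarith), Real.exp_le_exp]
  -- `√L ≤ θ L` iff `1 ≤ θ √L` iff `1/θ² ≤ L`
  have hs : Real.sqrt (Real.log y) * Real.sqrt (Real.log y) = Real.log y := Real.mul_self_sqrt hlog0
  have h1 : 1 / θ ≤ Real.sqrt (Real.log y) := by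
    rw [show 1 / θ = Real.sqrt (1 / θ ^ 2) by
      rw [Real.sqrt_div' _ (sq_nonneg θ) |>.trans (by rw [Real.sqrt_one, Real.sqrt_sq hθ.le])]]
    exact Real.sqrt_le_sqrt h
  have h2 : 1 ≤ θ * Real.sqrt (Real.log y) := by
    rw [div_le_iff₀ hθ] at h1; linarith
  calc Real.sqrt (Real.log y) = 1 * Real.sqrt (Real.log y) := (one_mul _).symm
    _ ≤ (θ * Real.sqrt (Real.log y)) * Real.sqrt (Real.log y) :=
        mul_le_mul_of_nonneg_right h2 (Real.sqrt_nonneg _)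
    _ = Real.log y * θ := by rw [mul_assoc, hs, mul_comm]

open scoped Classical in
/-- **Gallagher's theorem at a level without exceptional zero.** There are absolute `c, c₄ > 0` and
`C` such that for every `0 < θ ≤ c₄` and every `Y₀` there is a natural number `y ≥ Y₀` (`y ≥ 2`,
`exp(√log y) ≤ y^θ ≤ y^{c₄}`, no datum exceptional at level `(c, y^θ)`) for which, for all
`x, h ≤ y`,
`∑_{q ≤ y^θ} ∑*_{χ mod q} (h + y/y^θ)⁻¹ ‖∑#_{x−h<p≤x} χ(p) log p‖ ≤ C exp(−c/θ)`,
the sum over ALL primitive characters (for `q = 1`: `∑# = ∑_{x−h<p≤x} log p − #(x−h, x]`).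
(Gallagher's Theorem 7, first clause, at `N = y`, `P = y^θ`, `log N/log P = 1/θ`.)
[cite: Gallagher1970, Theorem 7] [cite: MontgomeryVaughan2007, Corollaries 11.8–11.10] -/
theorem gallagher_at_good_level :
    ∃ c : ℝ, 0 < c ∧ ∃ c₄ : ℝ, 0 < c₄ ∧ ∃ C : ℝ, ∀ θ : ℝ, 0 < θ → θ ≤ c₄ → ∀ Y₀ : ℕ,
      ∃ y : ℕ, Y₀ ≤ y ∧ 2 ≤ y ∧ Real.exp (Real.sqrt (Real.log y)) ≤ (y : ℝ) ^ θ ∧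
        (∀ (r : ℕ) [NeZero r] (χ : DirichletCharacter ℂ r) (β : ℝ),
          ¬ IsExceptionalZero c ((y : ℝ) ^ θ) r χ β) ∧
        ∀ (x h : (q : ℕ) → DirichletCharacter ℂ q → ℕ),
          (∀ q χ, x q χ ≤ y) → (∀ q χ, h q χ ≤ y) →
          ∑ q ∈ Icc 1 ⌊(y : ℝ) ^ θ⌋₊, ∑ χ : DirichletCharacter ℂ q with χ.IsPrimitive,
              ((h q χ : ℝ) + y / (y : ℝ) ^ θ)⁻¹ * ‖gallagherTerm χ (x q χ) (h q χ)‖ ≤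
            C * Real.exp (-c / θ) := by
  obtain ⟨c₀, hc₀, c₄, hc₄, hG⟩ := gallagher_nonexceptional_threshold
  obtain ⟨c₀', hc₀', hL⟩ := exists_level_without_exceptionalZero
  set c : ℝ := min c₀ c₀' with hcdef
  have hc : 0 < c := lt_min hc₀ hc₀'
  obtain ⟨C, hC⟩ := hG c hc (min_le_left _ _)
  refine ⟨c, hc, c₄, hc₄, C, fun θ hθ hθc₄ Y₀ => ?_⟩
  -- a good level beyond `max(Y₀, exp(1/θ²))`
  set Y₀' : ℕ := max Y₀ ⌈Real.exp (1 / θ ^ 2)⌉₊ with hY₀'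
  obtain ⟨y, hyY, hy2, -, hgood⟩ := hL c hc (min_le_right _ _) θ hθ Y₀'
  have hyY₀ : Y₀ ≤ y := (le_max_left _ _).trans hyY
  have hy1 : (1 : ℝ) ≤ y := by exact_mod_cast (by omega : 1 ≤ y)
  have hylog : 1 / θ ^ 2 ≤ Real.log y := by
    have h1 : Real.exp (1 / θ ^ 2) ≤ y := by
      calc Real.exp (1 / θ ^ 2) ≤ ⌈Real.exp (1 / θ ^ 2)⌉₊ := Nat.le_ceil _
        _ ≤ (Y₀' : ℝ) := by exact_mod_cast le_max_right _ _
        _ ≤ y := by exact_mod_cast hyY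
    have := Real.log_le_log (Real.exp_pos _) h1
    rwa [Real.log_exp] at this
  have hexp : Real.exp (Real.sqrt (Real.log y)) ≤ (y : ℝ) ^ θ := exp_sqrt_log_le_rpow hy1 hθ hylog
  have hPN : (y : ℝ) ^ θ ≤ (y : ℝ) ^ c₄ := Real.rpow_le_rpow_of_exponent_le hy1 hθc₄
  refine ⟨y, hyY₀, hy2, hexp, hgood, fun x h hx hh => ?_⟩
  have key := (hC y ((y : ℝ) ^ θ) hy2 hexp hPN x h hx hh).1 hgood
  have hlog : -c * Real.log y / Real.log ((y : ℝ) ^ θ) = -c / θ := by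
    have hlogy : 0 < Real.log y := Real.log_pos (by exact_mod_cast (by omega : 1 < y))
    rw [Real.log_rpow (by positivity)]
    field_simp
  rwa [hlog] at key

end Literature.NumberTheory.Sieve.MontgomeryVaughan1975

end
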